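import Summits.Schanuel.Schanuel.Theorems.ZilberEacBranchEqualOrderGrowth
import Summits.Schanuel.Schanuel.Theorems.ZilberEacCurveGraphFibreCase
import Summits.Schanuel.Schanuel.Theorems.ZilberEacEllipticBaseExample
import HarnessLib

/-!
# Arbitrary base branches, XVI: THE COMPLEX CIRCLE AS BASE CURVE — over `x₀² + x₁² = 1`, the
# surface `y₀ = x₁ − i x₀ + θ` is in Mantova–Masser's case AND dense (equal orders, direction `i`)

HONEST FRAMING.  Cell `pub-schanuel` (Zilber's Exponential-Algebraic Closedness, case ladder;
host summit Schanuel), seat 2, gen 28.  The circle `C : x₀² + x₁² = 1` has the two asymptotic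
directions `[1 : ±i : 0]` — NON-REAL.  Along the branch `x₀ = 1/s`, `x₁ = i√(1 − s²)/s`
(pole orders EQUAL, `Φ(0) = i`), the regular function `R = x₁ − i x₀ + θ` tends to `θ`.  File XV
(growth alone — no fibre relation, no transcendence step) and the certificates of files VI, VIII
give **`unprojectedDensityQuestion_circle_graphFibre`**: for every `θ ≠ 0` the surface
`{x₀² + x₁² − 1 = 0, y₀ = x₁ − i x₀ + θ} ⊆ ℂ² × ℂ²` is in Mantova–Masser's case (dim-π-S-1-free) AND
has Zariski-dense exponential points.  (Irreducibility of the circle: the discriminant `4 − 4x₀²` is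
not a square — a square root would vanish at `±1`, forcing `(x₀² − 1)² ∣ 4(1 − x₀²)`.)  A decided
instance of an OPEN question (Mantova–Masser, PLMS 2024 §1 p. 5) over a base curve with equal pole
orders at infinity; real-irrational directions stay OPEN; EC(3,2) OPEN; NOT Schanuel's conjecture
(neither used nor implied); EAC ⇏ SC.
-/

noncomputable section

open Filter Topology Set Complex MvPolynomial
open Literature.NumberTheory.Transcendental Literature.ModelTheory.Zilber
open Literature.ModelTheory.ExponentialFields

set_option linter.dupNamespace false

namespace Summit.Schanuel.Schanuel.Theorems

/-! ## Part A. The circle is irreducible -/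

/-- `4 − 4X²` is not a square in `ℂ[X]`. [folklore] -/
theorem four_sub_four_X_sq_ne_sq (r : Polynomial ℂ) :
    (4 - 4 * Polynomial.X ^ 2 : Polynomial ℂ) ≠ r ^ 2 := by
  intro h
  -- `r(1) = r(−1) = 0`
  have hr1 : r.IsRoot 1 := by
    have := congrArg (Polynomial.eval (1 : ℂ)) h
    simp only [Polynomial.eval_sub, Polynomial.eval_mul, Polynomial.eval_pow, Polynomial.eval_X,
      Polynomial.eval_ofNat, one_pow, mul_one, sub_self] at this
    exact pow_eq_zero_iff (two_ne_zero) |>.1 this.symm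
  have hr2 : r.IsRoot (-1) := by
    have := congrArg (Polynomial.eval (-1 : ℂ)) h
    simp only [Polynomial.eval_sub, Polynomial.eval_mul, Polynomial.eval_pow, Polynomial.eval_X,
      Polynomial.eval_ofNat] at this
    norm_num at this
    exact pow_eq_zero_iff (two_ne_zero) |>.1 this.symm
  -- `r = (X − 1)(X + 1) q`
  obtain ⟨r₁, hr₁⟩ := Polynomial.dvd_iff_isRoot.2 hr1
  have hr₁root : r₁.IsRoot (-1) := by
    have h2 := hr2
    rw [Polynomial.IsRoot, hr₁, Polynomial.eval_mul, Polynomial.eval_sub, Polynomial.eval_X,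
      Polynomial.eval_C] at h2
    norm_num at h2
    exact h2
  obtain ⟨q, hq⟩ := Polynomial.dvd_iff_isRoot.2 hr₁root
  rw [hq] at hr₁
  -- `4 − 4X² = −4 (X−1)(X+1)`, so `−4 = (X − 1)(X + 1) q²`
  have hX : (Polynomial.X - Polynomial.C (1 : ℂ)) * (Polynomial.X - Polynomial.C (-1 : ℂ)) ≠ 0 :=
    mul_ne_zero (Polynomial.X_sub_C_ne_zero 1) (Polynomial.X_sub_C_ne_zero (-1))
  have hid : (Polynomial.X - Polynomial.C (1 : ℂ)) * (Polynomial.X - Polynomial.C (-1 : ℂ)) *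
      (Polynomial.C (-4 : ℂ)) =
      (Polynomial.X - Polynomial.C (1 : ℂ)) * (Polynomial.X - Polynomial.C (-1 : ℂ)) *
      ((Polynomial.X - Polynomial.C (1 : ℂ)) * (Polynomial.X - Polynomial.C (-1 : ℂ)) * q ^ 2) := by
    have e : (4 - 4 * Polynomial.X ^ 2 : Polynomial ℂ) =
        (Polynomial.X - Polynomial.C (1 : ℂ)) * (Polynomial.X - Polynomial.C (-1 : ℂ)) *
          Polynomial.C (-4 : ℂ) := by
      simp only [map_neg, map_one, map_ofNat, sub_neg_eq_add]
      ring
    rw [← e, h, hr₁]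
    ring
  have hq2 := mul_left_cancel₀ hX hid
  have hq0 : q ≠ 0 := by
    intro h0
    rw [h0, zero_pow two_ne_zero, mul_zero] at hq2
    exact (by rw [Ne, Polynomial.C_eq_zero]; norm_num : Polynomial.C (-4 : ℂ) ≠ 0) hq2
  have hdeg := congrArg Polynomial.natDegree hq2
  rw [Polynomial.natDegree_C, Polynomial.natDegree_mul hX (pow_ne_zero _ hq0),
    Polynomial.natDegree_mul (Polynomial.X_sub_C_ne_zero 1) (Polynomial.X_sub_C_ne_zero (-1)),
    Polynomial.natDegree_X_sub_C, Polynomial.natDegree_X_sub_C] at hdeg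
  omega

/-- The circle relation `t² + (s² − 1)` is irreducible in `ℂ[s][t]`. [folklore] -/
theorem irreducible_circle_row :
    Irreducible (Polynomial.C (1 : Polynomial ℂ) * Polynomial.X ^ 2 +
      Polynomial.C (0 : Polynomial ℂ) * Polynomial.X +
      Polynomial.C (Polynomial.X ^ 2 - 1 : Polynomial ℂ)) := by
  refine irreducible_quadratic_of_disc_ne_sq one_ne_zero isCoprime_one_left fun r => ?_
  have e : (0 : Polynomial ℂ) ^ 2 - 4 * 1 * (Polynomial.X ^ 2 - 1) = 4 - 4 * Polynomial.X ^ 2 := by ring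
  rw [e]
  exact four_sub_four_X_sq_ne_sq r

/-- Evaluation of `x₀² + x₁² − 1`. -/
theorem eval_circleMv (x : Fin 2 → ℂ) :
    MvPolynomial.eval x (X 0 ^ 2 + X 1 ^ 2 - 1 : MvPolynomial (Fin 2) ℂ) = x 0 ^ 2 + x 1 ^ 2 - 1 := by
  simp

/-- Evaluation of `x₁ − i x₀ + θ`. -/
theorem eval_circleFibreMv (θ : ℂ) (x : Fin 2 → ℂ) :
    MvPolynomial.eval x (X 1 - MvPolynomial.C I * X 0 + MvPolynomial.C θ : MvPolynomial (Fin 2) ℂ) =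
      x 1 - I * x 0 + θ := by
  simp

/-- The circle polynomial and its rows. -/
theorem eval_circleMv_rows (x y : ℂ) :
    MvPolynomial.eval ![x, y] (X 0 ^ 2 + X 1 ^ 2 - 1 : MvPolynomial (Fin 2) ℂ) =
      ((Polynomial.C (1 : Polynomial ℂ) * Polynomial.X ^ 2 +
        Polynomial.C (0 : Polynomial ℂ) * Polynomial.X +
        Polynomial.C (Polynomial.X ^ 2 - 1 : Polynomial ℂ)).map (Polynomial.evalRingHom x)).eval y := by
  rw [evalPP_monicQuadratic, eval_circleMv]
  simp
  ring

/-- The circle `x₀² + x₁² − 1` is irreducible in `ℂ[x₀, x₁]`. [folklore] -/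
theorem irreducible_circleMv : Irreducible (X 0 ^ 2 + X 1 ^ 2 - 1 : MvPolynomial (Fin 2) ℂ) :=
  (irreducible_rows_iff eval_circleMv_rows).2 irreducible_circle_row

/-! ## Part B. The branch `x₀ = 1/s`, `x₁ = i√(1 − s²)/s` and density -/

/-- The analytic data: `q(v) = √(1 − v)` (principal), `q(0) = 1`, `q(v)² = 1 − v` near `0`, and the
difference quotient `d = dslope q 0` with `q(v) = 1 + v·d(v)`. [folklore] -/
theorem circle_branch_facts :
    ∃ q d : ℂ → ℂ, AnalyticAt ℂ q 0 ∧ AnalyticAt ℂ d 0 ∧ q 0 = 1 ∧ (∀ v, q v = 1 + v * d v) ∧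
      ∀ᶠ v in 𝓝 (0 : ℂ), q v ^ 2 = 1 - v := by
  set q : ℂ → ℂ := fun v => Complex.exp ((1 / 2 : ℂ) * Complex.log (1 - v)) with hq
  have h1v : AnalyticAt ℂ (fun v : ℂ => 1 - v) 0 := analyticAt_const.sub analyticAt_id
  have hqan : AnalyticAt ℂ q 0 :=
    (analyticAt_const.mul (h1v.clog (by simp [Complex.one_mem_slitPlane]))).cexp
  have hq0 : q 0 = 1 := by simp [hq]
  set d : ℂ → ℂ := dslope q 0 with hd
  have hdan : AnalyticAt ℂ d 0 := by
    obtain ⟨p, hp⟩ := hqan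
    exact ⟨_, hp.has_fpower_series_dslope_fslope⟩
  have hqd : ∀ v, q v = 1 + v * d v := fun v => by
    have h := eq_add_mul_dslope q v
    rwa [hq0] at h
  have hsmall : ∀ᶠ v in 𝓝 (0 : ℂ), ‖v‖ < 1 := by
    have := Metric.ball_mem_nhds (0 : ℂ) one_pos
    filter_upwards [this] with v hv
    rwa [Metric.mem_ball, dist_zero_right] at hv
  refine ⟨q, d, hqan, hdan, hq0, hqd, ?_⟩
  filter_upwards [hsmall] with v hv
  have hslit : 1 - v ∈ Complex.slitPlane := by
    have : 1 + (-v) ∈ Complex.slitPlane := Complex.mem_slitPlane_of_norm_lt_one (by rwa [norm_neg])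
    rwa [← sub_eq_add_neg] at this
  have hne0 : 1 - v ≠ 0 := Complex.slitPlane_ne_zero hslit
  rw [hq]
  simp only
  rw [← Complex.exp_nat_mul, ← mul_assoc, show ((2 : ℕ) : ℂ) * (1 / 2 : ℂ) = 1 by norm_num, one_mul]
  exact Complex.exp_log hne0

/-- **Over the complex circle `x₀² + x₁² = 1`, the surface `y₀ = x₁ − i x₀ + θ` (`θ ≠ 0`) has
Zariski-dense exponential points.**
[cite: MantovaMasser2023, §1 Further remarks, p. 5 (the question, open in general)] (new) -/
theorem unprojectedDense_circle_graphFibre {θ : ℂ} (hθ : θ ≠ 0) :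
    UnprojectedDense {w : Fin 2 ⊕ Fin 2 → ℂ |
      MvPolynomial.eval ![w (Sum.inl 0), w (Sum.inl 1)] (X 0 ^ 2 + X 1 ^ 2 - 1 : MvPolynomial (Fin 2) ℂ) = 0 ∧
      w (Sum.inr 0) = MvPolynomial.eval ![w (Sum.inl 0), w (Sum.inl 1)]
        (X 1 - MvPolynomial.C I * X 0 + MvPolynomial.C θ : MvPolynomial (Fin 2) ℂ)} := by
  have hS := isIrreducibleClosed_curveGraphFibre
    (X 1 - MvPolynomial.C I * X 0 + MvPolynomial.C θ : MvPolynomial (Fin 2) ℂ) irreducible_circleMv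
  have hdim := zariskiDim_curveGraphFibre
    (X 1 - MvPolynomial.C I * X 0 + MvPolynomial.C θ : MvPolynomial (Fin 2) ℂ) irreducible_circleMv
  obtain ⟨q, d, hqan, hdan, hq0, hqd, hq2⟩ := circle_branch_facts
  -- `Φ(s) = i q(s²)`, `ψ(s) = θ + i s d(s²)`
  set Φ : ℂ → ℂ := fun s => I * q (s ^ 2) with hΦ
  set ψ : ℂ → ℂ := fun s => θ + I * (s * d (s ^ 2)) with hψ
  have hsq : AnalyticAt ℂ (fun s : ℂ => s ^ 2) 0 := analyticAt_id.pow 2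
  have hΦan : AnalyticAt ℂ Φ 0 :=
    analyticAt_const.mul (hqan.comp_of_eq hsq (by simp))
  have hψan : AnalyticAt ℂ ψ 0 :=
    analyticAt_const.add (analyticAt_const.mul (analyticAt_id.mul (hdan.comp_of_eq hsq (by simp))))
  have hΦim : (Φ 0).im ≠ 0 := by simp [hΦ, hq0]
  have hψ0 : ψ 0 = θ := by simp [hψ]
  have hq2' : ∀ᶠ s in 𝓝 (0 : ℂ), q (s ^ 2) ^ 2 = 1 - s ^ 2 := by
    have hc : ContinuousAt (fun s : ℂ => s ^ 2) 0 := hsq.continuousAt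
    have h := hc.tendsto
    simp only [ne_eq, OfNat.ofNat_ne_zero, not_false_eq_true, zero_pow] at h
    exact h.eventually hq2
  have hgerm : ∀ᶠ s in 𝓝[≠] (0 : ℂ),
      (Sum.elim ![(s ^ 1)⁻¹, Φ s * (s ^ 1)⁻¹] ![ψ s, Complex.exp (Φ s * (s ^ 1)⁻¹)] :
        Fin 2 ⊕ Fin 2 → ℂ) ∈ {w : Fin 2 ⊕ Fin 2 → ℂ |
      MvPolynomial.eval ![w (Sum.inl 0), w (Sum.inl 1)] (X 0 ^ 2 + X 1 ^ 2 - 1 : MvPolynomial (Fin 2) ℂ) = 0 ∧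
      w (Sum.inr 0) = MvPolynomial.eval ![w (Sum.inl 0), w (Sum.inl 1)]
        (X 1 - MvPolynomial.C I * X 0 + MvPolynomial.C θ : MvPolynomial (Fin 2) ℂ)} := by
    filter_upwards [self_mem_nhdsWithin, nhdsWithin_le_nhds hq2'] with s (hs : s ≠ 0) hqs
    refine ⟨?_, ?_⟩
    · simp only [Sum.elim_inl, Matrix.cons_val_zero, Matrix.cons_val_one]
      rw [eval_circleMv]
      simp only [Matrix.cons_val_zero, Matrix.cons_val_one, pow_one, hΦ]
      have hI : I ^ 2 = -1 := Complex.I_sq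
      field_simp
      linear_combination (-1 : ℂ) * hqs + (q (s ^ 2)) ^ 2 * hI
    · simp only [Sum.elim_inr, Sum.elim_inl, Matrix.cons_val_zero, Matrix.cons_val_one]
      rw [eval_circleFibreMv]
      simp only [Matrix.cons_val_one, Matrix.cons_val_zero, pow_one, hΦ, hψ]
      have hd' := hqd (s ^ 2)
      field_simp
      linear_combination (-I) * hd'
  exact unprojectedDense_branch_equalOrder_of_im_ne_zero hS (le_of_eq hdim) (le_refl 1) hψan hθ hψ0
    hΦan hΦim hgerm

/-! ## Part C. The case certificate, and case ∧ dense -/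

/-- **The circle example is in Mantova–Masser's case (dim-π-S-1-free)** (every `θ`). (new) -/
theorem mmCase_circle_graphFibre (θ : ℂ) :
    MMCaseDimPiOneFree {w : Fin 2 ⊕ Fin 2 → ℂ |
      MvPolynomial.eval ![w (Sum.inl 0), w (Sum.inl 1)] (X 0 ^ 2 + X 1 ^ 2 - 1 : MvPolynomial (Fin 2) ℂ) = 0 ∧
      w (Sum.inr 0) = MvPolynomial.eval ![w (Sum.inl 0), w (Sum.inl 1)]
        (X 1 - MvPolynomial.C I * X 0 + MvPolynomial.C θ : MvPolynomial (Fin 2) ℂ)} := by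
  refine mmCase_curveGraphFibre irreducible_circleMv ?_ ?_
  · -- a point of the circle with `R ≠ 0`: `(1, 0)` unless `θ = i`, then `(−1, 0)`
    by_cases h : θ - I ≠ 0
    · refine ⟨![1, 0], by rw [eval_circleMv]; simp, ?_⟩
      rw [eval_circleFibreMv]
      simp only [Matrix.cons_val_one, Matrix.cons_val_zero, mul_one, zero_sub]
      intro h'
      apply h
      linear_combination h'
    · push Not at h
      refine ⟨![-1, 0], by rw [eval_circleMv]; simp, ?_⟩
      rw [eval_circleFibreMv]
      have : θ = I := by linear_combination h
      simp [this]
  · -- `(1,0)`, `(−1,0)`, `(0,1)` are not collinear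
    intro m hm c
    by_cases h1 : (m 0 : ℂ) * 1 + (m 1 : ℂ) * 0 ≠ c
    · exact ⟨![1, 0], by rw [eval_circleMv]; simp, by simpa using h1⟩
    by_cases h2 : (m 0 : ℂ) * (-1) + (m 1 : ℂ) * 0 ≠ c
    · exact ⟨![-1, 0], by rw [eval_circleMv]; simp, by simpa using h2⟩
    push Not at h1 h2
    refine ⟨![0, 1], by rw [eval_circleMv]; simp, ?_⟩
    simp only [Matrix.cons_val_zero, Matrix.cons_val_one, mul_zero, mul_one, zero_add]
    intro h3
    have hm0 : (m 0 : ℂ) = 0 := by linear_combination (h1 - h2) / 2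
    have hc : c = 0 := by linear_combination -h1 + hm0
    have hm1 : (m 1 : ℂ) = 0 := by rw [h3, hc]
    apply hm
    funext i
    fin_cases i
    · exact_mod_cast hm0
    · exact_mod_cast hm1

/-- **Mantova–Masser's question for the circle example: case ∧ dense** (`θ ≠ 0`).
[cite: MantovaMasser2023, §1 Further remarks, p. 5 (the question, open in general)] (new) -/
theorem unprojectedDensityQuestion_circle_graphFibre {θ : ℂ} (hθ : θ ≠ 0) :
    MMCaseDimPiOneFree {w : Fin 2 ⊕ Fin 2 → ℂ |
        MvPolynomial.eval ![w (Sum.inl 0), w (Sum.inl 1)] (X 0 ^ 2 + X 1 ^ 2 - 1 : MvPolynomial (Fin 2) ℂ) = 0 ∧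
        w (Sum.inr 0) = MvPolynomial.eval ![w (Sum.inl 0), w (Sum.inl 1)]
          (X 1 - MvPolynomial.C I * X 0 + MvPolynomial.C θ : MvPolynomial (Fin 2) ℂ)} ∧
      UnprojectedDense {w : Fin 2 ⊕ Fin 2 → ℂ |
        MvPolynomial.eval ![w (Sum.inl 0), w (Sum.inl 1)] (X 0 ^ 2 + X 1 ^ 2 - 1 : MvPolynomial (Fin 2) ℂ) = 0 ∧
        w (Sum.inr 0) = MvPolynomial.eval ![w (Sum.inl 0), w (Sum.inl 1)]
          (X 1 - MvPolynomial.C I * X 0 + MvPolynomial.C θ : MvPolynomial (Fin 2) ℂ)} :=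
  ⟨mmCase_circle_graphFibre θ, unprojectedDense_circle_graphFibre hθ⟩

/-- **Plain coordinates**: `{x₀² + x₁² = 1, y₀ = x₁ − i x₀ + θ}` (`θ ≠ 0`) is in the case AND dense.
[cite: MantovaMasser2023, §1 Further remarks, p. 5 (the question, open in general)] (new) -/
theorem unprojectedDensityQuestion_circle_graphFibre' {θ : ℂ} (hθ : θ ≠ 0) :
    MMCaseDimPiOneFree {w : Fin 2 ⊕ Fin 2 → ℂ |
        w (Sum.inl 0) ^ 2 + w (Sum.inl 1) ^ 2 - 1 = 0 ∧
        w (Sum.inr 0) = w (Sum.inl 1) - I * w (Sum.inl 0) + θ} ∧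
      UnprojectedDense {w : Fin 2 ⊕ Fin 2 → ℂ |
        w (Sum.inl 0) ^ 2 + w (Sum.inl 1) ^ 2 - 1 = 0 ∧
        w (Sum.inr 0) = w (Sum.inl 1) - I * w (Sum.inl 0) + θ} := by
  have e : {w : Fin 2 ⊕ Fin 2 → ℂ |
        MvPolynomial.eval ![w (Sum.inl 0), w (Sum.inl 1)] (X 0 ^ 2 + X 1 ^ 2 - 1 : MvPolynomial (Fin 2) ℂ) = 0 ∧
        w (Sum.inr 0) = MvPolynomial.eval ![w (Sum.inl 0), w (Sum.inl 1)]
          (X 1 - MvPolynomial.C I * X 0 + MvPolynomial.C θ : MvPolynomial (Fin 2) ℂ)} =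
      {w : Fin 2 ⊕ Fin 2 → ℂ | w (Sum.inl 0) ^ 2 + w (Sum.inl 1) ^ 2 - 1 = 0 ∧
        w (Sum.inr 0) = w (Sum.inl 1) - I * w (Sum.inl 0) + θ} := by
    ext w
    simp only [Set.mem_setOf_eq, eval_circleMv, eval_circleFibreMv, Matrix.cons_val_zero,
      Matrix.cons_val_one]
  have h := unprojectedDensityQuestion_circle_graphFibre hθ
  rw [e] at h
  exact h

end Summit.Schanuel.Schanuel.Theorems
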